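import Summits.Ventures.YMGap.RobustBall.AreaLawFrontierSU2W
import Summits.Ventures.YMGap.RobustBall.RobustAreaLawFrontierW3
import Summits.Ventures.YMGap.RobustBall.RobustAreaLawPairW
import HarnessLib

/-!
# Robust ball (Y2), area-law side — the tier-2 vertex FRONTIER cells of `SU(2)` (`d = 4`, `d = 3`) AT EVERY POSITIVE WEIGHT `κ > 0`

HONEST FRAMING. WHAT THIS IS: a venture file (cell `pub-ymgap`, track ROBUST-BALL; written by seat ds-2 (g13) on rb-p2 / ds-4's tier-2 area-law rows).
The weighted tier-2 area-law ball `AreaLawOnBallW 2 d (β_W/2) κ ε₀ ε₁ mv` (`ClusterDomain κ ε₀ ε₁ ∩ IsSlabLocal mv`, diameter weight `e^{κ·diam}`, NO range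
cut-off) was certified at the ONE weight `κ = log(6/5)`. The vertex row condition `rhoFR 2 (e^{κ/3}·3β_W/2) ε₀ ε₁ < 1` (`d = 4`; `e^{κ/2}·β_W` for `d = 3`) is
MONOTONE DECREASING in `κ` (`rhoFR_mono`), and the ball shrinks as `κ` grows (`AreaLawOnBallW.mono`); hence (`su2_areaLawOnBallW_posWeight`,
`su2_areaLawOnBallW_dim3_posWeight`) every certificate at `κ = log(6/5)` holds at EVERY `κ > 0` with UNCHANGED radii: the cells
`su2_frontierW_<cell>_posWeight : ∀ κ > 0, AreaLawOnBallW 2 4 (β_W/2) κ (2ε) ε mv` at (1/10,.436) (1/8,.395) (1/6,.331) (1/5,.279) (1/4,.218) (3/10,.171)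
(1/3,.144) (2/5,.100) (9/20,.072) (1/2,.048) (11/20,.027) (3/5,.009) and `su2_areaLawOnBallW_dim3_frontier_<cell>_posWeight` (`d = 3`, twelve cells
1/8 … 7/8). In words: Wilson's area law with constants uniform over the gauge-invariant slab-local perturbations of `SU(2)` Wilson of arbitrary range whose
loads are summable against ANY exponential weight `e^{κ·diam}`; and rb-p2's two ALL-`N` rows ('t Hooft 1/64 with (33/50, 33/100); 1/30 with
(1/10, 1/10)) at every weight: `suN_areaLawOnBallW_bakryEmery_dim4_row(')_posWeight`. WHAT THIS IS NOT: `κ = 0` is not reached; finite tori, uniform in the size; the frontier is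
the DOOR's; nothing about the continuum, a mass gap or the Millennium problem.
-/

noncomputable section

open MeasureTheory Real
open Literature.MathematicalPhysics.QuantumLattice (fundamentalRep)
open Literature.MathematicalPhysics.QuantumFieldTheory

namespace Summit.Ventures.YMGap.RobustBall

variable {N : ℕ}

/-! ### The row certificate at `κ = log(6/5)` serves every `κ > 0` -/

/-- **`d = 4`, every weight**: the majorised vertex certificate with `e^{κ/3} ≤ 1.0627` (valid for `κ ≤ log(6/5)`) gives `AreaLawOnBallW 2 4 (β_W/2) κ ε₀ ε₁ mv`
for EVERY `κ > 0` — below `log(6/5)` by `rhoFR_mono`, above by `AreaLawOnBallW.mono`. [folklore] -/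
theorem su2_areaLawOnBallW_posWeight {βW ε₀ ε₁ E : ℝ} (hβ : 0 ≤ βW) (hβ1 : 3 * βW / 2 ≤ 1) (h₁ : 0 ≤ ε₁) (hE : Real.exp ε₀ ≤ E)
    (hv1 : E * (1 + 2 * 1.41422 * ε₁) * (10627 / 10000 * (3 * βW / 2)) < 1) (hv2 : E * (10627 / 10000 * (3 * βW / 2)) + 1.41422 * ε₁ < 1)
    {κ : ℝ} (hκ : 0 < κ) {mv : ℕ} (hmv : 1 ≤ mv) : AreaLawOnBallW 2 4 (βW / 2) κ ε₀ ε₁ mv := by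
  have hcert : ∀ κ' : ℝ, 0 < κ' → κ' ≤ Real.log (6 / 5) → AreaLawOnBallW 2 4 (βW / 2) κ' ε₀ ε₁ mv := fun κ' hκ' hle =>
    su2_areaLawOnBallW_vertex_of_row hβ hβ1 hκ' h₁ hmv
      (rhoFR_two_lt_one_of_bounds (by positivity) h₁
        ((Real.exp_le_exp.2 (by linarith)).trans exp_log_six_fifths_div_three_le) hE sqrt_two_le hv1 hv2)
  by_cases hle : κ ≤ Real.log (6 / 5)
  · exact hcert κ hκ hle
  · exact (hcert _ (Real.log_pos (by norm_num)) le_rfl).mono (le_of_lt (not_le.1 hle)) le_rfl le_rfl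

/-- **`d = 3`, every weight**: the same with `e^{κ/2} ≤ 1.0955` and the `d = 3` vertex row `e^{κ/2}·β_W`. [folklore] -/
theorem su2_areaLawOnBallW_dim3_posWeight {βW ε₀ ε₁ E : ℝ} (hβ : 0 ≤ βW) (hβ1 : βW ≤ 1) (h₁ : 0 ≤ ε₁) (hE : Real.exp ε₀ ≤ E)
    (hv1 : E * (1 + 2 * 1.41422 * ε₁) * (10955 / 10000 * βW) < 1) (hv2 : E * (10955 / 10000 * βW) + 1.41422 * ε₁ < 1)
    {κ : ℝ} (hκ : 0 < κ) {mv : ℕ} (hmv : 1 ≤ mv) : AreaLawOnBallW 2 3 (βW / 2) κ ε₀ ε₁ mv := by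
  have hcert : ∀ κ' : ℝ, 0 < κ' → κ' ≤ Real.log (6 / 5) → AreaLawOnBallW 2 3 (βW / 2) κ' ε₀ ε₁ mv := fun κ' hκ' hle =>
    su2_areaLawOnBallW_dim3_vertex_of_row hβ hβ1 hκ' h₁ hmv
      (rhoFR_two_lt_one_of_bounds hβ h₁
        ((Real.exp_le_exp.2 (by linarith)).trans exp_log_six_fifths_div_two_le) hE sqrt_two_le hv1 hv2)
  by_cases hle : κ ≤ Real.log (6 / 5)
  · exact hcert κ hκ hle
  · exact (hcert _ (Real.log_pos (by norm_num)) le_rfl).mono (le_of_lt (not_le.1 hle)) le_rfl le_rfl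

/-! ### `d = 4` frontier cells at every weight -/

/-- Tier-2 frontier cell `(β_W, ε) = (1 / 10, 109 / 250)` AT EVERY WEIGHT `κ > 0`: `AreaLawOnBallW 2 4 (1 / 20) κ (109 / 125) (109 / 250) mv`. [folklore] -/
theorem su2_frontierW_1_10_posWeight {κ : ℝ} (hκ : 0 < κ) {mv : ℕ} (hmv : 1 ≤ mv) : AreaLawOnBallW 2 4 (1 / 20) κ (109 / 125) (109 / 250) mv := by
  rw [show (1 / 20 : ℝ) = 1 / 10 / 2 by norm_num]
  exact su2_areaLawOnBallW_posWeight (βW := 1 / 10) (by norm_num) (by norm_num) (by norm_num)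
    (exp_le_taylor4 (x := 109 / 125) (by norm_num) (by norm_num)) (by norm_num) (by norm_num) hκ hmv

/-- Tier-2 frontier cell `(β_W, ε) = (1 / 8, 79 / 200)` AT EVERY WEIGHT `κ > 0`: `AreaLawOnBallW 2 4 (1 / 16) κ (79 / 100) (79 / 200) mv`. [folklore] -/
theorem su2_frontierW_1_8_posWeight {κ : ℝ} (hκ : 0 < κ) {mv : ℕ} (hmv : 1 ≤ mv) : AreaLawOnBallW 2 4 (1 / 16) κ (79 / 100) (79 / 200) mv := by
  rw [show (1 / 16 : ℝ) = 1 / 8 / 2 by norm_num]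
  exact su2_areaLawOnBallW_posWeight (βW := 1 / 8) (by norm_num) (by norm_num) (by norm_num)
    (exp_le_taylor4 (x := 79 / 100) (by norm_num) (by norm_num)) (by norm_num) (by norm_num) hκ hmv

/-- Tier-2 frontier cell `(β_W, ε) = (1 / 6, 331 / 1000)` AT EVERY WEIGHT `κ > 0`: `AreaLawOnBallW 2 4 (1 / 12) κ (331 / 500) (331 / 1000) mv`. [folklore] -/
theorem su2_frontierW_1_6_posWeight {κ : ℝ} (hκ : 0 < κ) {mv : ℕ} (hmv : 1 ≤ mv) : AreaLawOnBallW 2 4 (1 / 12) κ (331 / 500) (331 / 1000) mv := by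
  rw [show (1 / 12 : ℝ) = 1 / 6 / 2 by norm_num]
  exact su2_areaLawOnBallW_posWeight (βW := 1 / 6) (by norm_num) (by norm_num) (by norm_num)
    (exp_le_taylor4 (x := 331 / 500) (by norm_num) (by norm_num)) (by norm_num) (by norm_num) hκ hmv

/-- Tier-2 frontier cell `(β_W, ε) = (1 / 5, 279 / 1000)` AT EVERY WEIGHT `κ > 0`: `AreaLawOnBallW 2 4 (1 / 10) κ (279 / 500) (279 / 1000) mv`. [folklore] -/
theorem su2_frontierW_1_5_posWeight {κ : ℝ} (hκ : 0 < κ) {mv : ℕ} (hmv : 1 ≤ mv) : AreaLawOnBallW 2 4 (1 / 10) κ (279 / 500) (279 / 1000) mv := by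
  rw [show (1 / 10 : ℝ) = 1 / 5 / 2 by norm_num]
  exact su2_areaLawOnBallW_posWeight (βW := 1 / 5) (by norm_num) (by norm_num) (by norm_num)
    (exp_le_taylor4 (x := 279 / 500) (by norm_num) (by norm_num)) (by norm_num) (by norm_num) hκ hmv

/-- Tier-2 frontier cell `(β_W, ε) = (1 / 4, 109 / 500)` AT EVERY WEIGHT `κ > 0`: `AreaLawOnBallW 2 4 (1 / 8) κ (109 / 250) (109 / 500) mv`. [folklore] -/
theorem su2_frontierW_1_4_posWeight {κ : ℝ} (hκ : 0 < κ) {mv : ℕ} (hmv : 1 ≤ mv) : AreaLawOnBallW 2 4 (1 / 8) κ (109 / 250) (109 / 500) mv := by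
  rw [show (1 / 8 : ℝ) = 1 / 4 / 2 by norm_num]
  exact su2_areaLawOnBallW_posWeight (βW := 1 / 4) (by norm_num) (by norm_num) (by norm_num)
    (exp_le_taylor4 (x := 109 / 250) (by norm_num) (by norm_num)) (by norm_num) (by norm_num) hκ hmv

/-- Tier-2 frontier cell `(β_W, ε) = (3 / 10, 171 / 1000)` AT EVERY WEIGHT `κ > 0`: `AreaLawOnBallW 2 4 (3 / 20) κ (171 / 500) (171 / 1000) mv`. [folklore] -/
theorem su2_frontierW_3_10_posWeight {κ : ℝ} (hκ : 0 < κ) {mv : ℕ} (hmv : 1 ≤ mv) : AreaLawOnBallW 2 4 (3 / 20) κ (171 / 500) (171 / 1000) mv := by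
  rw [show (3 / 20 : ℝ) = 3 / 10 / 2 by norm_num]
  exact su2_areaLawOnBallW_posWeight (βW := 3 / 10) (by norm_num) (by norm_num) (by norm_num)
    (exp_le_taylor4 (x := 171 / 500) (by norm_num) (by norm_num)) (by norm_num) (by norm_num) hκ hmv

/-- Tier-2 frontier cell `(β_W, ε) = (1 / 3, 18 / 125)` AT EVERY WEIGHT `κ > 0`: `AreaLawOnBallW 2 4 (1 / 6) κ (36 / 125) (18 / 125) mv`. [folklore] -/
theorem su2_frontierW_1_3_posWeight {κ : ℝ} (hκ : 0 < κ) {mv : ℕ} (hmv : 1 ≤ mv) : AreaLawOnBallW 2 4 (1 / 6) κ (36 / 125) (18 / 125) mv := by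
  rw [show (1 / 6 : ℝ) = 1 / 3 / 2 by norm_num]
  exact su2_areaLawOnBallW_posWeight (βW := 1 / 3) (by norm_num) (by norm_num) (by norm_num)
    (exp_le_taylor4 (x := 36 / 125) (by norm_num) (by norm_num)) (by norm_num) (by norm_num) hκ hmv

/-- Tier-2 frontier cell `(β_W, ε) = (9 / 20, 9 / 125)` AT EVERY WEIGHT `κ > 0`: `AreaLawOnBallW 2 4 (9 / 40) κ (18 / 125) (9 / 125) mv`. [folklore] -/
theorem su2_frontierW_9_20_posWeight {κ : ℝ} (hκ : 0 < κ) {mv : ℕ} (hmv : 1 ≤ mv) : AreaLawOnBallW 2 4 (9 / 40) κ (18 / 125) (9 / 125) mv := by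
  rw [show (9 / 40 : ℝ) = 9 / 20 / 2 by norm_num]
  exact su2_areaLawOnBallW_posWeight (βW := 9 / 20) (by norm_num) (by norm_num) (by norm_num)
    (exp_le_taylor4 (x := 18 / 125) (by norm_num) (by norm_num)) (by norm_num) (by norm_num) hκ hmv

/-- Tier-2 frontier cell `(β_W, ε) = (1 / 2, 6 / 125)` AT EVERY WEIGHT `κ > 0`: `AreaLawOnBallW 2 4 (1 / 4) κ (12 / 125) (6 / 125) mv`. [folklore] -/
theorem su2_frontierW_1_2_posWeight {κ : ℝ} (hκ : 0 < κ) {mv : ℕ} (hmv : 1 ≤ mv) : AreaLawOnBallW 2 4 (1 / 4) κ (12 / 125) (6 / 125) mv := by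
  rw [show (1 / 4 : ℝ) = 1 / 2 / 2 by norm_num]
  exact su2_areaLawOnBallW_posWeight (βW := 1 / 2) (by norm_num) (by norm_num) (by norm_num)
    (exp_le_taylor4 (x := 12 / 125) (by norm_num) (by norm_num)) (by norm_num) (by norm_num) hκ hmv

/-- Tier-2 frontier cell `(β_W, ε) = (11 / 20, 27 / 1000)` AT EVERY WEIGHT `κ > 0`: `AreaLawOnBallW 2 4 (11 / 40) κ (27 / 500) (27 / 1000) mv`. [folklore] -/
theorem su2_frontierW_11_20_posWeight {κ : ℝ} (hκ : 0 < κ) {mv : ℕ} (hmv : 1 ≤ mv) : AreaLawOnBallW 2 4 (11 / 40) κ (27 / 500) (27 / 1000) mv := by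
  rw [show (11 / 40 : ℝ) = 11 / 20 / 2 by norm_num]
  exact su2_areaLawOnBallW_posWeight (βW := 11 / 20) (by norm_num) (by norm_num) (by norm_num)
    (exp_le_taylor4 (x := 27 / 500) (by norm_num) (by norm_num)) (by norm_num) (by norm_num) hκ hmv

/-- Tier-2 frontier cell `(β_W, ε) = (3 / 5, 9 / 1000)` AT EVERY WEIGHT `κ > 0`: `AreaLawOnBallW 2 4 (3 / 10) κ (9 / 500) (9 / 1000) mv`. [folklore] -/
theorem su2_frontierW_3_5_posWeight {κ : ℝ} (hκ : 0 < κ) {mv : ℕ} (hmv : 1 ≤ mv) : AreaLawOnBallW 2 4 (3 / 10) κ (9 / 500) (9 / 1000) mv := by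
  rw [show (3 / 10 : ℝ) = 3 / 5 / 2 by norm_num]
  exact su2_areaLawOnBallW_posWeight (βW := 3 / 5) (by norm_num) (by norm_num) (by norm_num)
    (exp_le_taylor4 (x := 9 / 500) (by norm_num) (by norm_num)) (by norm_num) (by norm_num) hκ hmv

/-- Tier-2 frontier cell `(β_W, ε) = (2 / 5, 1 / 10)` AT EVERY WEIGHT `κ > 0`: `AreaLawOnBallW 2 4 (1 / 5) κ (1 / 5) (1 / 10) mv` (here `β = ε₀ = 1/5`, so the
coupling is normalised by `norm_num` instead of `rw`). [folklore] -/
theorem su2_frontierW_2_5_posWeight {κ : ℝ} (hκ : 0 < κ) {mv : ℕ} (hmv : 1 ≤ mv) : AreaLawOnBallW 2 4 (1 / 5) κ (1 / 5) (1 / 10) mv := by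
  have h := su2_areaLawOnBallW_posWeight (βW := 2 / 5) (ε₀ := 1 / 5) (ε₁ := 1 / 10) (by norm_num) (by norm_num) (by norm_num)
    (exp_le_taylor4 (x := 1 / 5) (by norm_num) (by norm_num)) (by norm_num) (by norm_num) hκ hmv
  norm_num at h
  exact h

/-! ### `d = 3` frontier cells at every weight -/

/-- `d = 3` tier-2 frontier cell `(β_W, ε) = (1 / 8, 231 / 500)` AT EVERY WEIGHT `κ > 0`: `AreaLawOnBallW 2 3 (1 / 16) κ (231 / 250) (231 / 500) mv`. [folklore] -/
theorem su2_areaLawOnBallW_dim3_frontier_oneEighth_posWeight {κ : ℝ} (hκ : 0 < κ) {mv : ℕ} (hmv : 1 ≤ mv) : AreaLawOnBallW 2 3 (1 / 16) κ (231 / 250) (231 / 500) mv := by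
  rw [show (1 / 16 : ℝ) = 1 / 8 / 2 by norm_num]
  exact su2_areaLawOnBallW_dim3_posWeight (βW := 1 / 8) (by norm_num) (by norm_num) (by norm_num)
    (exp_le_taylor4 (x := 231 / 250) (by norm_num) (by norm_num)) (by norm_num) (by norm_num) hκ hmv

/-- `d = 3` tier-2 frontier cell `(β_W, ε) = (1 / 5, 377 / 1000)` AT EVERY WEIGHT `κ > 0`: `AreaLawOnBallW 2 3 (1 / 10) κ (377 / 500) (377 / 1000) mv`. [folklore] -/
theorem su2_areaLawOnBallW_dim3_frontier_oneFifth_posWeight {κ : ℝ} (hκ : 0 < κ) {mv : ℕ} (hmv : 1 ≤ mv) : AreaLawOnBallW 2 3 (1 / 10) κ (377 / 500) (377 / 1000) mv := by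
  rw [show (1 / 10 : ℝ) = 1 / 5 / 2 by norm_num]
  exact su2_areaLawOnBallW_dim3_posWeight (βW := 1 / 5) (by norm_num) (by norm_num) (by norm_num)
    (exp_le_taylor4 (x := 377 / 500) (by norm_num) (by norm_num)) (by norm_num) (by norm_num) hκ hmv

/-- `d = 3` tier-2 frontier cell `(β_W, ε) = (1 / 4, 161 / 500)` AT EVERY WEIGHT `κ > 0`: `AreaLawOnBallW 2 3 (1 / 8) κ (161 / 250) (161 / 500) mv`. [folklore] -/
theorem su2_areaLawOnBallW_dim3_frontier_oneQuarter_posWeight {κ : ℝ} (hκ : 0 < κ) {mv : ℕ} (hmv : 1 ≤ mv) : AreaLawOnBallW 2 3 (1 / 8) κ (161 / 250) (161 / 500) mv := by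
  rw [show (1 / 8 : ℝ) = 1 / 4 / 2 by norm_num]
  exact su2_areaLawOnBallW_dim3_posWeight (βW := 1 / 4) (by norm_num) (by norm_num) (by norm_num)
    (exp_le_taylor4 (x := 161 / 250) (by norm_num) (by norm_num)) (by norm_num) (by norm_num) hκ hmv

/-- `d = 3` tier-2 frontier cell `(β_W, ε) = (3 / 10, 271 / 1000)` AT EVERY WEIGHT `κ > 0`: `AreaLawOnBallW 2 3 (3 / 20) κ (271 / 500) (271 / 1000) mv`. [folklore] -/
theorem su2_areaLawOnBallW_dim3_frontier_threeTenths_posWeight {κ : ℝ} (hκ : 0 < κ) {mv : ℕ} (hmv : 1 ≤ mv) : AreaLawOnBallW 2 3 (3 / 20) κ (271 / 500) (271 / 1000) mv := by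
  rw [show (3 / 20 : ℝ) = 3 / 10 / 2 by norm_num]
  exact su2_areaLawOnBallW_dim3_posWeight (βW := 3 / 10) (by norm_num) (by norm_num) (by norm_num)
    (exp_le_taylor4 (x := 271 / 500) (by norm_num) (by norm_num)) (by norm_num) (by norm_num) hκ hmv

/-- `d = 3` tier-2 frontier cell `(β_W, ε) = (1 / 3, 121 / 500)` AT EVERY WEIGHT `κ > 0`: `AreaLawOnBallW 2 3 (1 / 6) κ (121 / 250) (121 / 500) mv`. [folklore] -/
theorem su2_areaLawOnBallW_dim3_frontier_oneThird_posWeight {κ : ℝ} (hκ : 0 < κ) {mv : ℕ} (hmv : 1 ≤ mv) : AreaLawOnBallW 2 3 (1 / 6) κ (121 / 250) (121 / 500) mv := by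
  rw [show (1 / 6 : ℝ) = 1 / 3 / 2 by norm_num]
  exact su2_areaLawOnBallW_dim3_posWeight (βW := 1 / 3) (by norm_num) (by norm_num) (by norm_num)
    (exp_le_taylor4 (x := 121 / 250) (by norm_num) (by norm_num)) (by norm_num) (by norm_num) hκ hmv

/-- `d = 3` tier-2 frontier cell `(β_W, ε) = (2 / 5, 193 / 1000)` AT EVERY WEIGHT `κ > 0`: `AreaLawOnBallW 2 3 (1 / 5) κ (193 / 500) (193 / 1000) mv`. [folklore] -/
theorem su2_areaLawOnBallW_dim3_frontier_twoFifths_posWeight {κ : ℝ} (hκ : 0 < κ) {mv : ℕ} (hmv : 1 ≤ mv) : AreaLawOnBallW 2 3 (1 / 5) κ (193 / 500) (193 / 1000) mv := by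
  rw [show (1 / 5 : ℝ) = 2 / 5 / 2 by norm_num]
  exact su2_areaLawOnBallW_dim3_posWeight (βW := 2 / 5) (by norm_num) (by norm_num) (by norm_num)
    (exp_le_taylor4 (x := 193 / 500) (by norm_num) (by norm_num)) (by norm_num) (by norm_num) hκ hmv

/-- `d = 3` tier-2 frontier cell `(β_W, ε) = (1 / 2, 137 / 1000)` AT EVERY WEIGHT `κ > 0`: `AreaLawOnBallW 2 3 (1 / 4) κ (137 / 500) (137 / 1000) mv`. [folklore] -/
theorem su2_areaLawOnBallW_dim3_frontier_oneHalf_posWeight {κ : ℝ} (hκ : 0 < κ) {mv : ℕ} (hmv : 1 ≤ mv) : AreaLawOnBallW 2 3 (1 / 4) κ (137 / 500) (137 / 1000) mv := by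
  rw [show (1 / 4 : ℝ) = 1 / 2 / 2 by norm_num]
  exact su2_areaLawOnBallW_dim3_posWeight (βW := 1 / 2) (by norm_num) (by norm_num) (by norm_num)
    (exp_le_taylor4 (x := 137 / 500) (by norm_num) (by norm_num)) (by norm_num) (by norm_num) hκ hmv

/-- `d = 3` tier-2 frontier cell `(β_W, ε) = (3 / 5, 93 / 1000)` AT EVERY WEIGHT `κ > 0`: `AreaLawOnBallW 2 3 (3 / 10) κ (93 / 500) (93 / 1000) mv`. [folklore] -/
theorem su2_areaLawOnBallW_dim3_frontier_threeFifths_posWeight {κ : ℝ} (hκ : 0 < κ) {mv : ℕ} (hmv : 1 ≤ mv) : AreaLawOnBallW 2 3 (3 / 10) κ (93 / 500) (93 / 1000) mv := by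
  rw [show (3 / 10 : ℝ) = 3 / 5 / 2 by norm_num]
  exact su2_areaLawOnBallW_dim3_posWeight (βW := 3 / 5) (by norm_num) (by norm_num) (by norm_num)
    (exp_le_taylor4 (x := 93 / 500) (by norm_num) (by norm_num)) (by norm_num) (by norm_num) hκ hmv

/-- `d = 3` tier-2 frontier cell `(β_W, ε) = (2 / 3, 17 / 250)` AT EVERY WEIGHT `κ > 0`: `AreaLawOnBallW 2 3 (1 / 3) κ (17 / 125) (17 / 250) mv`. [folklore] -/
theorem su2_areaLawOnBallW_dim3_frontier_twoThirds_posWeight {κ : ℝ} (hκ : 0 < κ) {mv : ℕ} (hmv : 1 ≤ mv) : AreaLawOnBallW 2 3 (1 / 3) κ (17 / 125) (17 / 250) mv := by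
  rw [show (1 / 3 : ℝ) = 2 / 3 / 2 by norm_num]
  exact su2_areaLawOnBallW_dim3_posWeight (βW := 2 / 3) (by norm_num) (by norm_num) (by norm_num)
    (exp_le_taylor4 (x := 17 / 125) (by norm_num) (by norm_num)) (by norm_num) (by norm_num) hκ hmv

/-- `d = 3` tier-2 frontier cell `(β_W, ε) = (3 / 4, 21 / 500)` AT EVERY WEIGHT `κ > 0`: `AreaLawOnBallW 2 3 (3 / 8) κ (21 / 250) (21 / 500) mv`. [folklore] -/
theorem su2_areaLawOnBallW_dim3_frontier_threeQuarters_posWeight {κ : ℝ} (hκ : 0 < κ) {mv : ℕ} (hmv : 1 ≤ mv) : AreaLawOnBallW 2 3 (3 / 8) κ (21 / 250) (21 / 500) mv := by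
  rw [show (3 / 8 : ℝ) = 3 / 4 / 2 by norm_num]
  exact su2_areaLawOnBallW_dim3_posWeight (βW := 3 / 4) (by norm_num) (by norm_num) (by norm_num)
    (exp_le_taylor4 (x := 21 / 250) (by norm_num) (by norm_num)) (by norm_num) (by norm_num) hκ hmv

/-- `d = 3` tier-2 frontier cell `(β_W, ε) = (4 / 5, 27 / 1000)` AT EVERY WEIGHT `κ > 0`: `AreaLawOnBallW 2 3 (2 / 5) κ (27 / 500) (27 / 1000) mv`. [folklore] -/
theorem su2_areaLawOnBallW_dim3_frontier_fourFifths_posWeight {κ : ℝ} (hκ : 0 < κ) {mv : ℕ} (hmv : 1 ≤ mv) : AreaLawOnBallW 2 3 (2 / 5) κ (27 / 500) (27 / 1000) mv := by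
  rw [show (2 / 5 : ℝ) = 4 / 5 / 2 by norm_num]
  exact su2_areaLawOnBallW_dim3_posWeight (βW := 4 / 5) (by norm_num) (by norm_num) (by norm_num)
    (exp_le_taylor4 (x := 27 / 500) (by norm_num) (by norm_num)) (by norm_num) (by norm_num) hκ hmv

/-- `d = 3` tier-2 frontier cell `(β_W, ε) = (7 / 8, 1 / 125)` AT EVERY WEIGHT `κ > 0`: `AreaLawOnBallW 2 3 (7 / 16) κ (2 / 125) (1 / 125) mv`. [folklore] -/
theorem su2_areaLawOnBallW_dim3_frontier_sevenEighths_posWeight {κ : ℝ} (hκ : 0 < κ) {mv : ℕ} (hmv : 1 ≤ mv) : AreaLawOnBallW 2 3 (7 / 16) κ (2 / 125) (1 / 125) mv := by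
  rw [show (7 / 16 : ℝ) = 7 / 8 / 2 by norm_num]
  exact su2_areaLawOnBallW_dim3_posWeight (βW := 7 / 8) (by norm_num) (by norm_num) (by norm_num)
    (exp_le_taylor4 (x := 2 / 125) (by norm_num) (by norm_num)) (by norm_num) (by norm_num) hκ hmv

/-! ### Every `N ≥ 2`: the two all-`N` tier-2 area-law rows at every weight -/

/-- **ALL-`N` TIER-2 AREA-LAW ROW AT EVERY WEIGHT** ('t Hooft `1/64`, radii `(33/50, 33/100)`): for EVERY `N ≥ 2`, EVERY `κ > 0` and `mv ≥ 1`,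
`AreaLawOnBallW N 4 (N/64) κ (33/50) (33/100) mv` (rb-p2's `suN_areaLawOnBallW_bakryEmery_dim4_row` at `κ = log(6/5)`, transported: below `log(6/5)`
the row value only decreases, above the ball only shrinks). [folklore] -/
theorem suN_areaLawOnBallW_bakryEmery_dim4_row_posWeight (hN : 2 ≤ N) {κ : ℝ} (hκ : 0 < κ) {mv : ℕ} (hmv : 1 ≤ mv) :
    AreaLawOnBallW N 4 ((N : ℝ) * (1 / 64)) κ (33 / 50) (33 / 100) mv := by
  have hcert : ∀ κ' : ℝ, 0 < κ' → κ' ≤ Real.log (6 / 5) → AreaLawOnBallW N 4 ((N : ℝ) * (1 / 64)) κ' (33 / 50) (33 / 100) mv := by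
    intro κ' hκ' hle
    show AreaLawOnBallW N (3 + 1) _ _ _ _ mv
    have habs : |(1 / 64 : ℝ)| * (2 * ((3 : ℕ) : ℝ)) = 3 / 32 := by rw [abs_of_pos (by norm_num)]; push_cast; norm_num
    refine suN_areaLawOnBallW_bakryEmery (n := 3) hN (by norm_num) hκ' (by rw [habs]; norm_num) hmv ?_
    rw [habs]
    have hE₀ := exp_le_taylor4 (x := (33 / 50 : ℝ)) (by norm_num) (by norm_num)
    have hEh : Real.exp ((33 / 50 : ℝ) / 2) ≤ 1 + 33 / 100 + (33 / 100) ^ 2 / 2 + (33 / 100) ^ 3 / 6 + 5 / 96 * (33 / 100) ^ 4 := by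
      rw [show ((33 / 50 : ℝ) / 2) = 33 / 100 by norm_num]; exact exp_le_taylor4 (by norm_num) (by norm_num)
    have hs := le_sqrt_nat_mul hN (D := 1 / 2 - 3 / 32) (s₀ := 9 / 10) (by norm_num) (by norm_num) (by norm_num)
    have hE₃ : Real.exp (κ' / 3) ≤ 10627 / 10000 :=
      (Real.exp_le_exp.2 (by linarith)).trans exp_log_six_fifths_div_three_le
    have h := suN_row_lt_one_of_bounds (w := κ' / 3) (ε₁ := 33 / 100) (q := (3 / 32) / (1 / 2 - 3 / 32)) (by norm_num) (by norm_num)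
      hE₃ hE₀ hEh (by norm_num) hs (by norm_num)
    calc Real.exp (κ' / ((3 : ℕ) : ℝ)) * (Real.exp (33 / 50) * (3 / 32 : ℝ) / (1 / 2 - 3 / 32)) +
          Real.exp (33 / 50 / 2) * (33 / 100) / Real.sqrt ((N : ℝ) * (1 / 2 - 3 / 32))
        = Real.exp (κ' / 3) * (Real.exp (33 / 50) * ((3 / 32 : ℝ) / (1 / 2 - 3 / 32))) +
            Real.exp (33 / 50 / 2) * (33 / 100) / Real.sqrt ((N : ℝ) * (1 / 2 - 3 / 32)) := by push_cast; ring
      _ < 1 := h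
  by_cases hle : κ ≤ Real.log (6 / 5)
  · exact hcert κ hκ hle
  · exact (hcert _ (Real.log_pos (by norm_num)) le_rfl).mono (le_of_lt (not_le.1 hle)) le_rfl le_rfl

/-- **ALL-`N` TIER-2 AREA-LAW ROW AT EVERY WEIGHT, row-1f radii** ('t Hooft `1/30`, radii `(1/10, 1/10)`): for EVERY `N ≥ 2`, EVERY `κ > 0` and `mv ≥ 1`,
`AreaLawOnBallW N 4 (N/30) κ (1/10) (1/10) mv`. [folklore] -/
theorem suN_areaLawOnBallW_bakryEmery_dim4_row'_posWeight (hN : 2 ≤ N) {κ : ℝ} (hκ : 0 < κ) {mv : ℕ} (hmv : 1 ≤ mv) :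
    AreaLawOnBallW N 4 ((N : ℝ) * (1 / 30)) κ (1 / 10) (1 / 10) mv := by
  have hcert : ∀ κ' : ℝ, 0 < κ' → κ' ≤ Real.log (6 / 5) → AreaLawOnBallW N 4 ((N : ℝ) * (1 / 30)) κ' (1 / 10) (1 / 10) mv := by
    intro κ' hκ' hle
    show AreaLawOnBallW N (3 + 1) _ _ _ _ mv
    have habs : |(1 / 30 : ℝ)| * (2 * ((3 : ℕ) : ℝ)) = 1 / 5 := by rw [abs_of_pos (by norm_num)]; push_cast; norm_num
    refine suN_areaLawOnBallW_bakryEmery (n := 3) hN (by norm_num) hκ' (by rw [habs]; norm_num) hmv ?_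
    rw [habs]
    have hE₀ := exp_le_taylor4 (x := (1 / 10 : ℝ)) (by norm_num) (by norm_num)
    have hEh : Real.exp ((1 / 10 : ℝ) / 2) ≤ 1 + 1 / 20 + (1 / 20) ^ 2 / 2 + (1 / 20) ^ 3 / 6 + 5 / 96 * (1 / 20) ^ 4 := by
      rw [show ((1 / 10 : ℝ) / 2) = 1 / 20 by norm_num]; exact exp_le_taylor4 (by norm_num) (by norm_num)
    have hs := le_sqrt_nat_mul hN (D := 1 / 2 - 1 / 5) (s₀ := 77 / 100) (by norm_num) (by norm_num) (by norm_num)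
    have hE₃ : Real.exp (κ' / 3) ≤ 10627 / 10000 :=
      (Real.exp_le_exp.2 (by linarith)).trans exp_log_six_fifths_div_three_le
    have h := suN_row_lt_one_of_bounds (w := κ' / 3) (ε₁ := 1 / 10) (q := (1 / 5) / (1 / 2 - 1 / 5)) (by norm_num) (by norm_num)
      hE₃ hE₀ hEh (by norm_num) hs (by norm_num)
    calc Real.exp (κ' / ((3 : ℕ) : ℝ)) * (Real.exp (1 / 10) * (1 / 5 : ℝ) / (1 / 2 - 1 / 5)) +
          Real.exp (1 / 10 / 2) * (1 / 10) / Real.sqrt ((N : ℝ) * (1 / 2 - 1 / 5))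
        = Real.exp (κ' / 3) * (Real.exp (1 / 10) * ((1 / 5 : ℝ) / (1 / 2 - 1 / 5))) +
            Real.exp (1 / 10 / 2) * (1 / 10) / Real.sqrt ((N : ℝ) * (1 / 2 - 1 / 5)) := by push_cast; ring
      _ < 1 := h
  by_cases hle : κ ≤ Real.log (6 / 5)
  · exact hcert κ hκ hle
  · exact (hcert _ (Real.log_pos (by norm_num)) le_rfl).mono (le_of_lt (not_le.1 hle)) le_rfl le_rfl

end Summit.Ventures.YMGap.RobustBall

end
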